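import Literature.MathematicalPhysics.QuantumFieldTheory.Balaban1983to89.Node00.Record13CarriersCoPHChi
import Literature.MathematicalPhysics.QuantumFieldTheory.Balaban1983to89.Node00.Record13CarriersSepCoPH
import Literature.MathematicalPhysics.QuantumFieldTheory.Balaban1983to89.Node00.Record13SepCoPHChi

/-!
# NODE 00 (YM-PLAN Track A) — THE STAGE-13 CARRIER STACK AT THE **χ-GENERIC** v1.7 `SepCoPH` RECORD: dag-n10-d's `Node00/Record13CarriersSepCoPH` §1 (the v1.7 separated-range
# provisos transport along every re-binding and pin; their datum is UP-SIDE) RE-ISSUED over `[Ax-3d]`'s χ-generic carriers (`Node00/Record13SepCoPHChi`: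
# `Stage13HParams.Provisos₁₃SepCoPHChi`, `datumOfRecord₁₃SepCoPHChi`) — χ-FIXED, sibling of `Record13CarriersCoPHChi` (WORK ORDER RC-1, director-ym №462 (B) ∕ №467 (D))

WHAT.  dag-n10-d's `Record13CarriersSepCoPH.lean` §1 rows `Stage13HParams.Provisos₁₃SepCoPH.rebindX ∕ .pinB10 ∕ .pinY ∕ .pinZ ∕ .pinW ∕ .pinB8 ∕ .pinB12 ∕ .pinB8Sub ∕ .pinB13 ∕ .pinX3`
(field by field ∕ instances) and `datumOfRecord₁₃SepCoPH_rebindX ∕ _pinB10 ∕ _pinY ∕ _pinZ ∕ _pinW ∕ _pinB8 ∕ _pinB12 ∕ _pinB8Sub ∕ _pinB13 ∕ _pinX3` (`rfl`, UP-SIDE) VERBATIM with the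
β-slot small-field function a FIXED parameter `(χ : ChiSlot F N)` after `θ` (`Provisos₁₃SepCoPH F N ↦ Provisos₁₃SepCoPHChi F N χ`, `datumOfRecord₁₃SepCoPH F N θ h ↦ datumOfRecord₁₃SepCoPHChi F N θ χ h`;
names `X ↦ X_chi`, dot-rows on the χ structure; the `zetaMeas` row supplied explicitly).  §2 of the parent (the choice-centred record `IsRecordOfRecord₁₃CSepCoPH` presented at pinned views) is
NOT re-issued here — at χ the record classes are node00-def-Y's `IsRecordOfRecord₁₃CSepCoPHCmap ∕ CAx` (`Record13SepCoPHChiCmap`) and this seat's `IsRecordOfRecord₁₃CSepCoPHSCmap ∕ SAx`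
(`Record13SClassSepCoPHChiCmap`); their hosting rows at pinned views follow in the consumer (the N24 glue's χ edition) from the rows below.

WHY NOW (seat `pub-ymgap-dag-n24-c` g23, op 5b ENGINE-LANE HAND): the decl-level cone census of the K1 chain of record (`ConeCensusK1.lean`, pub-ymgap INBOX I.22211) lists these 20 rows
among the centre-TYPED constants WITHOUT a χ twin that the K1 engine's six-pin world reaches (through `N24_recordG₁₃SepCoPH_of_up_withB8_rebindX_pinB10Y₀ZW₀` ∕
`N24_isRecordOfRecord₁₃CCoPH_of_up_pinB10Y₀ZW₀`); the Ax re-issue of the engine (K1ᴬ stmt-QuantumFields-27239) reads them at `χ := chiβOfRecord₁₃Ax F N θ.toStage13Params`.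

WHAT IS HERE (theorems only; append-only NEW leaf; nothing landed is edited; 0 `def`):
* `Stage13HParams.Provisos₁₃SepCoPHChi.rebindX ∕ .pinB10 ∕ .pinY ∕ .pinZ ∕ .pinW ∕ .pinB8 ∕ .pinB12 ∕ .pinB8Sub ∕ .pinB13 ∕ .pinX3`;
* `datumOfRecord₁₃SepCoPH_rebindX_chi ∕ _pinB10_chi ∕ _pinY_chi ∕ _pinZ_chi ∕ _pinW_chi ∕ _pinB8_chi ∕ _pinB12_chi ∕ _pinB8Sub_chi ∕ _pinB13_chi ∕ _pinX3_chi` (`rfl`).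

References (objects of record; bookkeeping): [III] = [Balaban1988Convergent] Commun. Math. Phys. **119** (1988), (2.18) p.257, (2.23)–(2.42) pp.259–262, (3.2)–(3.9) pp.265–266;
[Balaban1985RegularSpaces] (1.3)–(1.6) p.77; [V] = [Balaban1989LargeFieldII] Thm 1 + (0.1) pp.355–356; [Balaban1985UV3] Thm 1 p.257; [I] = [Balaban1987RG1] (2.9) p.266.

HONEST FRAMING: kernel bookkeeping only (`rfl`, anonymous-constructor records on landed χ-generic structures); NO estimate; nothing of Bałaban's asserted; provisos stay HYPOTHESES; no
proviso inhabited; no node discharged; K0ᴬ∕K1ᴬ∕K3ᴬ OPEN; counts unmoved (discharged 8∕27 · K 1∕4); one finite 𝕋⁴ programme at fixed ε = L^{−K} — NOT continuum ∕ ℝ⁴ ∕ OS ∕ mass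
gap ∕ Clay.  No `sorry`, no `axiom`, no `instance`, no `notation`; standard axioms.  Seat `pub-ymgap-dag-n24-c` g23 (`--supports stmt-QuantumFields-27239 --as helper`, count-neutral).
-/

noncomputable section

namespace Literature.MathematicalPhysics.QuantumFieldTheory.Balaban1983to89.Node00

open T4Continuum AveragingRT T4FiniteEpsInhabited FlowStep FlowStepRuns DagBinding T4DatumAssembly
open scoped Matrix.Norms.L2Operator

variable {F : T4Family} {N : ℕ} [NeZero N]

/-! ## §1χ. The χ-generic v1.7 separated-range provisos transport along every X-re-binding and every pin; their χ-generic datum is UP-SIDE -/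

section SepCoPHChi

/-- **The v1.7 provisos read no carrier**: they transport along ANY `X`-re-binding (ten rows, field by field; row `bg` reads `γ`, `gOfRecord₁₃`,
`PartCompat₁₃`, `settingOfRecord₁₃`, `Rz`, `τ9`, `suppOfRecord₁₃SepCoP`, `UbgOfRecord₁₃CoP` — never `res.X`). [cite: Balaban1988Convergent, (2.18) p.257, (2.23)–(2.42) pp.259–262, (3.2)–(3.9) pp.265–266; Balaban1985RegularSpaces, (1.3)–(1.6) p.77 (bookkeeping)] -/
theorem Stage13HParams.Provisos₁₃SepCoPHChi.rebindX {θ : Stage13HParams F N} {χ : ChiSlot F N} (h : θ.Provisos₁₃SepCoPHChi F N χ) (X' : B12.RunParams → PrintedCarriersR) :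
    (θ.rebindX F N X').Provisos₁₃SepCoPHChi F N χ :=
  { intPiece := h.intPiece, measω := h.measω, measChi := h.measChi, zetaUnity := h.zetaUnity, zetaAbs := h.zetaAbs, rstep := h.rstep, rzLaws := h.rzLaws,
    zhLaws := h.zhLaws, zhLocal := h.zhLocal, hM := h.hM, hM₁ := h.hM₁, bg := h.bg, zetaMeas := h.zetaMeas }

/-- … along the [B10] pin … [cite: Balaban1988Convergent, (2.23)–(2.42) pp.259–262 (bookkeeping)] -/
theorem Stage13HParams.Provisos₁₃SepCoPHChi.pinB10 {θ : Stage13HParams F N} {χ : ChiSlot F N} (h : θ.Provisos₁₃SepCoPHChi F N χ) : (θ.pinB10 F N).Provisos₁₃SepCoPHChi F N χ :=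
  h.rebindX _

/-- … the Y pin … [cite: Balaban1988Convergent, (2.23)–(2.42) pp.259–262 (bookkeeping)] -/
theorem Stage13HParams.Provisos₁₃SepCoPHChi.pinY {θ : Stage13HParams F N} {χ : ChiSlot F N} (h : θ.Provisos₁₃SepCoPHChi F N χ) (Y₀ : PrintedCarriers9X) : (θ.pinY F N Y₀).Provisos₁₃SepCoPHChi F N χ :=
  { intPiece := h.intPiece, measω := h.measω, measChi := h.measChi, zetaUnity := h.zetaUnity, zetaAbs := h.zetaAbs, rstep := h.rstep, rzLaws := h.rzLaws,
    zhLaws := h.zhLaws, zhLocal := h.zhLocal, hM := h.hM, hM₁ := h.hM₁, bg := h.bg, zetaMeas := h.zetaMeas }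

/-- … the Z pin … [cite: Balaban1988Convergent, (2.23)–(2.42) pp.259–262 (bookkeeping)] -/
theorem Stage13HParams.Provisos₁₃SepCoPHChi.pinZ {θ : Stage13HParams F N} {χ : ChiSlot F N} (h : θ.Provisos₁₃SepCoPHChi F N χ) (Z₀ : PrintedCarriers11) : (θ.pinZ F N Z₀).Provisos₁₃SepCoPHChi F N χ :=
  { intPiece := h.intPiece, measω := h.measω, measChi := h.measChi, zetaUnity := h.zetaUnity, zetaAbs := h.zetaAbs, rstep := h.rstep, rzLaws := h.rzLaws,
    zhLaws := h.zhLaws, zhLocal := h.zhLocal, hM := h.hM, hM₁ := h.hM₁, bg := h.bg, zetaMeas := h.zetaMeas }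

/-- … the W pin … [cite: Balaban1988Convergent, (2.23)–(2.42) pp.259–262 (bookkeeping)] -/
theorem Stage13HParams.Provisos₁₃SepCoPHChi.pinW {θ : Stage13HParams F N} {χ : ChiSlot F N} (h : θ.Provisos₁₃SepCoPHChi F N χ) (W₀ : B12.RunParams → PrintedCarriers15) :
    (θ.pinW F N W₀).Provisos₁₃SepCoPHChi F N χ :=
  { intPiece := h.intPiece, measω := h.measω, measChi := h.measChi, zetaUnity := h.zetaUnity, zetaAbs := h.zetaAbs, rstep := h.rstep, rzLaws := h.rzLaws,
    zhLaws := h.zhLaws, zhLocal := h.zhLocal, hM := h.hM, hM₁ := h.hM₁, bg := h.bg, zetaMeas := h.zetaMeas }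

/-- … the [B8] pin … [cite: Balaban1988Convergent, (2.23)–(2.42) pp.259–262 (bookkeeping)] -/
theorem Stage13HParams.Provisos₁₃SepCoPHChi.pinB8 {θ : Stage13HParams F N} {χ : ChiSlot F N} (h : θ.Provisos₁₃SepCoPHChi F N χ) (lam : ResidB8 θ.toStage3Params) : (θ.pinB8 F N lam).Provisos₁₃SepCoPHChi F N χ :=
  h.rebindX _

/-- … the [B12] pin … [cite: Balaban1988Convergent, (2.23)–(2.42) pp.259–262 (bookkeeping)] -/
theorem Stage13HParams.Provisos₁₃SepCoPHChi.pinB12 {θ : Stage13HParams F N} {χ : ChiSlot F N} (h : θ.Provisos₁₃SepCoPHChi F N χ) (lam : ResidB12 F N θ.τ9.M) : (θ.pinB12 F N lam).Provisos₁₃SepCoPHChi F N χ :=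
  h.rebindX _

/-- … the [B8′] pin … [cite: Balaban1988Convergent, (2.23)–(2.42) pp.259–262 (bookkeeping)] -/
theorem Stage13HParams.Provisos₁₃SepCoPHChi.pinB8Sub {θ : Stage13HParams F N} {χ : ChiSlot F N} (h : θ.Provisos₁₃SepCoPHChi F N χ) (lam : ResidB8 θ.toStage3Params) : (θ.pinB8Sub F N lam).Provisos₁₃SepCoPHChi F N χ :=
  h.rebindX _

/-- … the [B13] pin … [cite: Balaban1988Convergent, (2.23)–(2.42) pp.259–262; Balaban1988RG2Cluster, Lemmas 1–3 pp.9–20 (bookkeeping)] -/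
theorem Stage13HParams.Provisos₁₃SepCoPHChi.pinB13 {θ : Stage13HParams F N} {χ : ChiSlot F N} (h : θ.Provisos₁₃SepCoPHChi F N χ) (lam : B12.RunParams → ResidB13 θ.toStage3Params) :
    (θ.pinB13 F N lam).Provisos₁₃SepCoPHChi F N χ :=
  h.rebindX _

/-- … and the one-level X-pin of the three carrier groups of record. [cite: Balaban1988Convergent, (2.23)–(2.42) pp.259–262 (bookkeeping)] -/
theorem Stage13HParams.Provisos₁₃SepCoPHChi.pinX3 {θ : Stage13HParams F N} {χ : ChiSlot F N} (h : θ.Provisos₁₃SepCoPHChi F N χ) (lam8 : ResidB8 θ.toStage3Params) (lam12 : ResidB12 F N θ.τ9.M)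
    (lam13 : B12.RunParams → ResidB13 θ.toStage3Params) : (θ.pinX3 F N lam8 lam12 lam13).Provisos₁₃SepCoPHChi F N χ :=
  h.rebindX _

variable (F N)

/-- **THE v1.7 DATUM DOES NOT READ THE CARRIER BUNDLE `X`** (`rfl`, once, at a generic re-binding). [cite: Balaban1989LargeFieldII, Thm 1 + (0.1) pp.355–356 (bookkeeping)] -/
theorem datumOfRecord₁₃SepCoPH_rebindX_chi (θ : Stage13HParams F N) (χ : ChiSlot F N) (h : θ.Provisos₁₃SepCoPHChi F N χ) (X' : B12.RunParams → PrintedCarriersR)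
    (h' : (θ.rebindX F N X').Provisos₁₃SepCoPHChi F N χ) : datumOfRecord₁₃SepCoPHChi F N (θ.rebindX F N X') χ h' = datumOfRecord₁₃SepCoPHChi F N θ χ h := rfl

/-- **THE PINS ARE UP-SIDE at the v1.7 datum**: the [B10] pin (`rfl`) … [cite: Balaban1989LargeFieldII, Thm 1 + (0.1) pp.355–356; Balaban1985UV3, Thm 1 p.257 (bookkeeping)] -/
theorem datumOfRecord₁₃SepCoPH_pinB10_chi (θ : Stage13HParams F N) (χ : ChiSlot F N) (h : θ.Provisos₁₃SepCoPHChi F N χ) :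
    datumOfRecord₁₃SepCoPHChi F N (θ.pinB10 F N) χ h.pinB10 = datumOfRecord₁₃SepCoPHChi F N θ χ h :=
  datumOfRecord₁₃SepCoPH_rebindX_chi F N θ χ h _ h.pinB10

/-- … the Y pin (`rfl`) … [cite: Balaban1989LargeFieldII, Thm 1 + (0.1) pp.355–356 (bookkeeping)] -/
theorem datumOfRecord₁₃SepCoPH_pinY_chi (θ : Stage13HParams F N) (χ : ChiSlot F N) (h : θ.Provisos₁₃SepCoPHChi F N χ) (Y₀ : PrintedCarriers9X) :
    datumOfRecord₁₃SepCoPHChi F N (θ.pinY F N Y₀) χ (h.pinY Y₀) = datumOfRecord₁₃SepCoPHChi F N θ χ h := rfl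

/-- … the Z pin (`rfl`) … [cite: Balaban1989LargeFieldII, Thm 1 + (0.1) pp.355–356 (bookkeeping)] -/
theorem datumOfRecord₁₃SepCoPH_pinZ_chi (θ : Stage13HParams F N) (χ : ChiSlot F N) (h : θ.Provisos₁₃SepCoPHChi F N χ) (Z₀ : PrintedCarriers11) :
    datumOfRecord₁₃SepCoPHChi F N (θ.pinZ F N Z₀) χ (h.pinZ Z₀) = datumOfRecord₁₃SepCoPHChi F N θ χ h := rfl

/-- … the W pin (`rfl`) … [cite: Balaban1989LargeFieldII, Thm 1 + (0.1) pp.355–356 (bookkeeping)] -/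
theorem datumOfRecord₁₃SepCoPH_pinW_chi (θ : Stage13HParams F N) (χ : ChiSlot F N) (h : θ.Provisos₁₃SepCoPHChi F N χ) (W₀ : B12.RunParams → PrintedCarriers15) :
    datumOfRecord₁₃SepCoPHChi F N (θ.pinW F N W₀) χ (h.pinW W₀) = datumOfRecord₁₃SepCoPHChi F N θ χ h := rfl

/-- … the [B8] pin (`rfl`) … [cite: Balaban1989LargeFieldII, Thm 1 + (0.1) pp.355–356 (bookkeeping)] -/
theorem datumOfRecord₁₃SepCoPH_pinB8_chi (θ : Stage13HParams F N) (χ : ChiSlot F N) (h : θ.Provisos₁₃SepCoPHChi F N χ) (lam : ResidB8 θ.toStage3Params) :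
    datumOfRecord₁₃SepCoPHChi F N (θ.pinB8 F N lam) χ (h.pinB8 lam) = datumOfRecord₁₃SepCoPHChi F N θ χ h :=
  datumOfRecord₁₃SepCoPH_rebindX_chi F N θ χ h _ (h.pinB8 lam)

/-- … the [B12] pin (`rfl`) … [cite: Balaban1989LargeFieldII, Thm 1 + (0.1) pp.355–356 (bookkeeping)] -/
theorem datumOfRecord₁₃SepCoPH_pinB12_chi (θ : Stage13HParams F N) (χ : ChiSlot F N) (h : θ.Provisos₁₃SepCoPHChi F N χ) (lam : ResidB12 F N θ.τ9.M) :
    datumOfRecord₁₃SepCoPHChi F N (θ.pinB12 F N lam) χ (h.pinB12 lam) = datumOfRecord₁₃SepCoPHChi F N θ χ h :=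
  datumOfRecord₁₃SepCoPH_rebindX_chi F N θ χ h _ (h.pinB12 lam)

/-- … the [B8′] pin (`rfl`) … [cite: Balaban1989LargeFieldII, Thm 1 + (0.1) pp.355–356 (bookkeeping)] -/
theorem datumOfRecord₁₃SepCoPH_pinB8Sub_chi (θ : Stage13HParams F N) (χ : ChiSlot F N) (h : θ.Provisos₁₃SepCoPHChi F N χ) (lam : ResidB8 θ.toStage3Params) :
    datumOfRecord₁₃SepCoPHChi F N (θ.pinB8Sub F N lam) χ (h.pinB8Sub lam) = datumOfRecord₁₃SepCoPHChi F N θ χ h :=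
  datumOfRecord₁₃SepCoPH_rebindX_chi F N θ χ h _ (h.pinB8Sub lam)

/-- … the [B13] pin (`rfl`) … [cite: Balaban1989LargeFieldII, Thm 1 + (0.1) pp.355–356; Balaban1988RG2Cluster, Lemmas 1–3 pp.9–20 (bookkeeping)] -/
theorem datumOfRecord₁₃SepCoPH_pinB13_chi (θ : Stage13HParams F N) (χ : ChiSlot F N) (h : θ.Provisos₁₃SepCoPHChi F N χ) (lam : B12.RunParams → ResidB13 θ.toStage3Params) :
    datumOfRecord₁₃SepCoPHChi F N (θ.pinB13 F N lam) χ (h.pinB13 lam) = datumOfRecord₁₃SepCoPHChi F N θ χ h :=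
  datumOfRecord₁₃SepCoPH_rebindX_chi F N θ χ h _ (h.pinB13 lam)

/-- … and the one-level X-pin (`rfl`). [cite: Balaban1989LargeFieldII, Thm 1 + (0.1) pp.355–356 (bookkeeping)] -/
theorem datumOfRecord₁₃SepCoPH_pinX3_chi (θ : Stage13HParams F N) (χ : ChiSlot F N) (h : θ.Provisos₁₃SepCoPHChi F N χ) (lam8 : ResidB8 θ.toStage3Params) (lam12 : ResidB12 F N θ.τ9.M)
    (lam13 : B12.RunParams → ResidB13 θ.toStage3Params) :
    datumOfRecord₁₃SepCoPHChi F N (θ.pinX3 F N lam8 lam12 lam13) χ (h.pinX3 lam8 lam12 lam13) = datumOfRecord₁₃SepCoPHChi F N θ χ h :=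
  datumOfRecord₁₃SepCoPH_rebindX_chi F N θ χ h _ (h.pinX3 lam8 lam12 lam13)

end SepCoPHChi

end Literature.MathematicalPhysics.QuantumFieldTheory.Balaban1983to89.Node00

end
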